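import Summits.AtomisticToContinuum.Crystallization.Theorems.FrustratedLawDichotomyTailFloorRangeCut

/-!
# FrustratedLawDichotomy · the tail floor with the ANNULUS layer-cake constant — `TailFloor 7 (1/324)` PROVED

Critic row 484 / lens-5 g34 erratum: beneath lens-5 g33's range cut the STRAINED population must self-finance `ε_R + (eUp − e⋆)`, so a
tail floor `TailFloor R A` is usable at range `R` iff its slack `ε_R = A·s⋆⁻³ − |t_R(fcc⋆)|` is `≤ 3.5·10⁻³` (TRUE-type) and `≤ 1.75·10⁻³`
for the `×2` margin the declared residual `T′_7` (floor `A_7 = 1/324`, KNOWN-type) enjoys; "a new floor moves the residual iff its slack meets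
`1.75·10⁻³` AND the floor is PROVED".  `…TailFloorSharp` (p826874) gave `A_R = (4/3)(1+1/(2R))³/R³` (`ε_7 = 3.6·10⁻³`: misses).
Here the SAME layer cake is run with the ANNULUS packing — far sites' half-balls lie in `B(p, t+½) ∖ B(p, R−½)`, so
`Σ_{R ≤ r_j ≤ t} min(nn_j,1)³ ≤ 8((t+½)³ − (R−½)³)` — and the polynomial integral is evaluated exactly:

  `A_R = (4/3)R⁻³ + (3/2)R⁻⁴ + (3/5)R⁻⁵ + (1/12)R⁻⁶ − (2/3)(R−½)³R⁻⁶`   (`R ≥ 1/2`),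

`A_7 = 2.992·10⁻³ ≤ 3/1000 ≤ 1/324`: ★ `tailFloor_seven_324 : TailFloor 7 (1/324)` — lens-5's literal floor at the residual of record `T′_7`
is now a THEOREM (slack `3/1000·s⋆⁻³ − |t_7| ≈ 1.67·10⁻³ ≤ 1.75·10⁻³`, the `×2` criterion), and `fdg_of_rangeCut_seven` /
`T′_7 = FiniteRangeTopologicalPricing (1/20) (1/8) 7 (1/324) (−0.7175) (1/100) C_T` lose their `hT` (`fdg_of_rangeCut_seven_tf`,
`fdg_of_split_rangeCut_seven_tf`, crux twins).  Also `A_6 ≤ 101/20000` (`tailFloor_six`, TRUE-type-thin `ε_6 ≈ 3.1·10⁻³`).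

DEF-FREE; 0 sorry.  Prover hand 1, gen 12 (decomp-a2c), --supports stmt-AtomisticToContinuum-27623.  [folklore: layer cake + annulus packing]
-/

noncomputable section

namespace Summit.AtomisticToContinuum.Crystallization.Theorems.FrustratedLawDichotomyTailFloor

open scoped BigOperators ENNReal
open Metric Set Module MeasureTheory
open Literature.MathematicalPhysics.StatisticalMechanics (interactionEnergy lennardJones)
open Literature.Geometry.DiscreteGeometry (nearestDist nearestDist_le_dist nearestDist_nonneg)
open Summit.AtomisticToContinuum.Crystallization.Theorems.FrustratedLawDichotomyRangeCut

variable {N : ℕ}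

/-! ## 1. Annulus packing by volume -/

open scoped Function in
/-- **Annulus packing by volume.** Finitely many pairwise disjoint balls `B(c_j, ρ_j)` (`ρ_j > 0`) of a finite-dimensional real normed space,
inside `B(p, L)` (`dist c_j p + ρ_j ≤ L`) and outside `B(p, ℓ)` (`ℓ + ρ_j ≤ dist c_j p`, `0 < ℓ`), satisfy `Σ_j ρ_j^dim + ℓ^dim ≤ L^dim`.
[folklore] -/
theorem sum_pow_finrank_add_le_of_disjoint_balls {E : Type*} [NormedAddCommGroup E] [NormedSpace ℝ E] [FiniteDimensional ℝ E]
    {ι : Type*} (s : Finset ι) (c : ι → E) (ρ : ι → ℝ) (p : E) {ℓ L : ℝ}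
    (hρ : ∀ j ∈ s, 0 < ρ j) (hℓ : 0 < ℓ) (hℓL : ℓ ≤ L)
    (hdisj : ∀ j ∈ s, ∀ k ∈ s, j ≠ k → ρ j + ρ k ≤ dist (c j) (c k))
    (hin : ∀ j ∈ s, dist (c j) p + ρ j ≤ L) (hout : ∀ j ∈ s, ℓ + ρ j ≤ dist (c j) p) :
    ∑ j ∈ s, ρ j ^ finrank ℝ E + ℓ ^ finrank ℝ E ≤ L ^ finrank ℝ E := by
  classical
  have hLpos : 0 < L := hℓ.trans_le hℓL
  borelize E
  let μ : Measure E := Measure.addHaar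
  set A := ⋃ j ∈ s, ball (c j) (ρ j) with hA
  have D : Set.Pairwise (s : Set ι) (Disjoint on fun j => ball (c j) (ρ j)) := by
    rintro j hj k hk hjk
    exact ball_disjoint_ball (hdisj j hj k hk hjk)
  have A_subset : A ∪ ball p ℓ ⊆ ball p L := by
    refine union_subset (iUnion₂_subset fun j hj => ball_subset_ball' ?_) (ball_subset_ball hℓL)
    linarith [hin j hj, dist_comm (c j) p]
  have A_disj : Disjoint A (ball p ℓ) := by
    rw [Set.disjoint_left]
    intro x hxA hxB
    rw [hA, mem_iUnion₂] at hxA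
    obtain ⟨j, hj, hx⟩ := hxA
    rw [mem_ball] at hx hxB
    have := dist_triangle (c j) x p
    rw [dist_comm (c j) x] at this
    linarith [hout j hj]
  have hμA : μ A = ∑ j ∈ s, ENNReal.ofReal (ρ j ^ finrank ℝ E) * μ (ball 0 1) := by
    rw [hA, measure_biUnion_finset D fun j _ => measurableSet_ball]
    exact Finset.sum_congr rfl fun j hj => by rw [μ.addHaar_ball_of_pos _ (hρ j hj)]
  have I : ENNReal.ofReal (∑ j ∈ s, ρ j ^ finrank ℝ E + ℓ ^ finrank ℝ E) * μ (ball 0 1) ≤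
      ENNReal.ofReal (L ^ finrank ℝ E) * μ (ball 0 1) :=
    calc ENNReal.ofReal (∑ j ∈ s, ρ j ^ finrank ℝ E + ℓ ^ finrank ℝ E) * μ (ball 0 1)
        = (∑ j ∈ s, ENNReal.ofReal (ρ j ^ finrank ℝ E)) * μ (ball 0 1) + ENNReal.ofReal (ℓ ^ finrank ℝ E) * μ (ball 0 1) := by
          rw [ENNReal.ofReal_add (Finset.sum_nonneg fun j hj => pow_nonneg (hρ j hj).le _) (pow_nonneg hℓ.le _),
            ENNReal.ofReal_sum_of_nonneg (fun j hj => pow_nonneg (hρ j hj).le _), add_mul]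
      _ = μ A + μ (ball p ℓ) := by rw [hμA, Finset.sum_mul, μ.addHaar_ball_of_pos _ hℓ]
      _ = μ (A ∪ ball p ℓ) := (measure_union A_disj measurableSet_ball).symm
      _ ≤ μ (ball p L) := measure_mono A_subset
      _ = ENNReal.ofReal (L ^ finrank ℝ E) * μ (ball 0 1) := by rw [μ.addHaar_ball_of_pos _ hLpos]
  have J : ENNReal.ofReal (∑ j ∈ s, ρ j ^ finrank ℝ E + ℓ ^ finrank ℝ E) ≤ ENNReal.ofReal (L ^ finrank ℝ E) :=
    (ENNReal.mul_le_mul_iff_left (measure_ball_pos _ _ zero_lt_one).ne' measure_ball_lt_top.ne).1 I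
  exact (ENNReal.ofReal_le_ofReal_iff (by positivity)).1 J

/-- **Weighted count in an annulus**: for a `7/10`-separated cluster, a centre `p` and `1/2 < R ≤ b`,
`Σ_{j : R ≤ dist (y j) p ≤ b} min(nn_j,1)³ ≤ 8((b + ½)³ − (R − ½)³)`. [folklore] -/
theorem sum_weight_le_of_mem_annulus (y : Fin N → (EuclideanSpace ℝ (Fin 3)))
    (hsep : ∀ a b : Fin N, a ≠ b → (7 : ℝ) / 10 ≤ dist (y a) (y b))
    (p : (EuclideanSpace ℝ (Fin 3))) {R b : ℝ} (hR : 1 / 2 < R) (hRb : R ≤ b) (s : Finset (Fin N))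
    (hlo : ∀ j ∈ s, R ≤ dist (y j) p) (hhi : ∀ j ∈ s, dist (y j) p ≤ b) :
    ∑ j ∈ s, (min (nearestDist y j) 1) ^ 3 ≤ 8 * ((b + 1 / 2) ^ 3 - (R - 1 / 2) ^ 3) := by
  by_cases hN : ∀ j : Fin N, ∃ k, k ≠ j
  · have hρ : ∀ j ∈ s, 0 < min (nearestDist y j) 1 / 2 := fun j _ =>
      div_pos (lt_min (by linarith [nearestDist_ge y hsep (hN j)]) one_pos) two_pos
    have h := sum_pow_finrank_add_le_of_disjoint_balls s y (fun j => min (nearestDist y j) 1 / 2) p hρ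
      (ℓ := R - 1 / 2) (L := b + 1 / 2) (by linarith) (by linarith) ?_ ?_ ?_
    · rw [finrank_euclideanSpace_fin] at h
      calc ∑ j ∈ s, (min (nearestDist y j) 1) ^ 3 = 8 * ∑ j ∈ s, (min (nearestDist y j) 1 / 2) ^ 3 := by
            rw [Finset.mul_sum]; exact Finset.sum_congr rfl fun j _ => by ring
        _ ≤ 8 * ((b + 1 / 2) ^ 3 - (R - 1 / 2) ^ 3) := by linarith
    · intro j _ k _ hjk
      have h1 : nearestDist y j ≤ dist (y j) (y k) := nearestDist_le_dist y (Ne.symm hjk)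
      have h2 : nearestDist y k ≤ dist (y j) (y k) := by rw [dist_comm]; exact nearestDist_le_dist y hjk
      have h3 := min_le_left (nearestDist y j) 1
      have h4 := min_le_left (nearestDist y k) 1
      linarith
    · intro j hj
      have := min_le_right (nearestDist y j) 1
      linarith [hhi j hj]
    · intro j hj
      have := min_le_right (nearestDist y j) 1
      show R - 1 / 2 + min (nearestDist y j) 1 / 2 ≤ dist (y j) p
      linarith [hlo j hj]
  · obtain ⟨j₀, hj₀⟩ := not_forall.1 hN
    have hall : ∀ k, k = j₀ := fun k => by
      by_contra hk
      exact hj₀ ⟨k, hk⟩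
    haveI : Subsingleton (Fin N) := ⟨fun a c => (hall a).trans (hall c).symm⟩
    have h0 : ∀ j, nearestDist y j = 0 := fun j => Literature.Geometry.DiscreteGeometry.nearestDist_eq_zero_of_subsingleton y j
    simp only [h0]
    norm_num
    have h1 : (R - 1 / 2) ^ 3 ≤ (b + 1 / 2) ^ 3 := pow_le_pow_left₀ (by linarith) (by linarith) 3
    linarith

/-! ## 2. The weighted far field, annulus layer cake -/

/-- **The weighted far field at a site, annulus constant**: for `R > 1/2` and any centre `p`,
`Σ_{j : r_j ≥ R} r_j⁻⁶ min(nn_j,1)³ ≤ 16R⁻³ + 18R⁻⁴ + (36/5)R⁻⁵ + R⁻⁶ − 8(R−½)³R⁻⁶`. [folklore] -/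
theorem sum_far_weight_le_annulus (y : Fin N → (EuclideanSpace ℝ (Fin 3)))
    (hsep : ∀ a b : Fin N, a ≠ b → (7 : ℝ) / 10 ≤ dist (y a) (y b))
    (p : (EuclideanSpace ℝ (Fin 3))) {R : ℝ} (hR : 1 / 2 < R) (s : Finset (Fin N)) (hfar : ∀ j ∈ s, R ≤ dist (y j) p) :
    ∑ j ∈ s, (dist (y j) p)⁻¹ ^ 6 * (min (nearestDist y j) 1) ^ 3 ≤
      16 * (R ^ 3)⁻¹ + 18 * (R ^ 4)⁻¹ + 36 / 5 * (R ^ 5)⁻¹ + (R ^ 6)⁻¹ - 8 * (R - 1 / 2) ^ 3 * (R ^ 6)⁻¹ := by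
  classical
  have hR0 : 0 < R := by linarith
  set w : Fin N → ℝ := fun j => (min (nearestDist y j) 1) ^ 3 with hw
  set K : ℝ := (R - 1 / 2) ^ 3 with hK
  have hK0 : 0 ≤ K := pow_nonneg (by linarith) 3
  have hdpos : ∀ j ∈ s, 0 < dist (y j) p := fun j hj => hR0.trans_le (hfar j hj)
  have hint : ∀ a : ℝ, a < -1 → IntegrableOn (fun t : ℝ => t ^ a) (Ioi R) := fun a ha => integrableOn_Ioi_rpow_of_lt ha hR0
  -- layer cake for each term
  have hterm : ∀ j ∈ s, (dist (y j) p)⁻¹ ^ 6 * w j =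
      ∫ t in Ioi R, (Ioi (dist (y j) p)).indicator (fun t : ℝ => 6 * w j * t ^ (-7 : ℝ)) t := by
    intro j hj
    rw [setIntegral_indicator measurableSet_Ioi, Set.Ioi_inter_Ioi, sup_eq_right.2 (hfar j hj),
      inv_pow_six_eq_integral (hdpos j hj)]
    rw [show (fun t : ℝ => 6 * w j * t ^ (-7 : ℝ)) = fun t => (6 * w j) * t ^ (-7 : ℝ) from rfl,
      integral_const_mul]
    ring
  have hint_term : ∀ j ∈ s, IntegrableOn (fun t => (Ioi (dist (y j) p)).indicator (fun t : ℝ => 6 * w j * t ^ (-7 : ℝ)) t)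
      (Ioi R) := fun j _ => ((hint (-7) (by norm_num)).const_mul (6 * w j)).indicator measurableSet_Ioi
  have hsum_eq : ∑ j ∈ s, (dist (y j) p)⁻¹ ^ 6 * w j =
      ∫ t in Ioi R, ∑ j ∈ s, (Ioi (dist (y j) p)).indicator (fun t : ℝ => 6 * w j * t ^ (-7 : ℝ)) t := by
    rw [integral_finsetSum _ hint_term]
    exact Finset.sum_congr rfl hterm
  -- the majorant: `g t = 48 (t⁻⁴ + (3/2)t⁻⁵ + (3/4)t⁻⁶ + (1/8)t⁻⁷) − 48 K t⁻⁷`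
  set g : ℝ → ℝ := fun t => 48 * t ^ (-4 : ℝ) + 72 * t ^ (-5 : ℝ) + 36 * t ^ (-6 : ℝ) + (6 - 48 * K) * t ^ (-7 : ℝ) with hg
  have hint_g : IntegrableOn g (Ioi R) := by
    rw [hg]
    exact ((((hint (-4) (by norm_num)).const_mul 48).add ((hint (-5) (by norm_num)).const_mul 72)).add
      ((hint (-6) (by norm_num)).const_mul 36)).add ((hint (-7) (by norm_num)).const_mul (6 - 48 * K))
  -- pointwise bound of the integrand
  have hpt : ∀ t ∈ Ioi R, ∑ j ∈ s, (Ioi (dist (y j) p)).indicator (fun t : ℝ => 6 * w j * t ^ (-7 : ℝ)) t ≤ g t := by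
    intro t ht
    have htR : R < t := ht
    have ht0 : 0 < t := hR0.trans htR
    have hind : ∀ j ∈ s, (Ioi (dist (y j) p)).indicator (fun t : ℝ => 6 * w j * t ^ (-7 : ℝ)) t =
        if dist (y j) p < t then 6 * t ^ (-7 : ℝ) * w j else 0 := by
      intro j _
      simp only [Set.indicator, Set.mem_Ioi]
      split_ifs <;> ring
    rw [Finset.sum_congr rfl hind, ← Finset.sum_filter, ← Finset.mul_sum]
    have hW : ∑ j ∈ s.filter (fun j => dist (y j) p < t), w j ≤ 8 * ((t + 1 / 2) ^ 3 - K) :=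
      sum_weight_le_of_mem_annulus y hsep p hR htR.le _ (fun j hj => hfar j (Finset.mem_filter.1 hj).1)
        fun j hj => (Finset.mem_filter.1 hj).2.le
    have h7 : 0 ≤ 6 * t ^ (-7 : ℝ) := by positivity
    have h74 : t ^ (-7 : ℝ) * t ^ 3 = t ^ (-4 : ℝ) := by
      rw [← Real.rpow_natCast t 3, ← Real.rpow_add ht0]; norm_num
    have h75 : t ^ (-7 : ℝ) * t ^ 2 = t ^ (-5 : ℝ) := by
      rw [← Real.rpow_natCast t 2, ← Real.rpow_add ht0]; norm_num
    have h76 : t ^ (-7 : ℝ) * t = t ^ (-6 : ℝ) := by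
      conv_lhs => rw [show t ^ (-7 : ℝ) * t = t ^ (-7 : ℝ) * t ^ (1 : ℝ) by rw [Real.rpow_one]]
      rw [← Real.rpow_add ht0]; norm_num
    calc 6 * t ^ (-7 : ℝ) * ∑ j ∈ s.filter (fun j => dist (y j) p < t), w j
        ≤ 6 * t ^ (-7 : ℝ) * (8 * ((t + 1 / 2) ^ 3 - K)) := mul_le_mul_of_nonneg_left hW h7
      _ = 48 * (t ^ (-7 : ℝ) * t ^ 3) + 72 * (t ^ (-7 : ℝ) * t ^ 2) + 36 * (t ^ (-7 : ℝ) * t) +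
            (6 - 48 * K) * t ^ (-7 : ℝ) := by ring
      _ = g t := by rw [h74, h75, h76]
  -- integrate the majorant exactly
  have hI : ∀ a : ℝ, a < -1 → ∫ t in Ioi R, t ^ a = -R ^ (a + 1) / (a + 1) := fun a ha => integral_Ioi_rpow_of_lt ha hR0
  have hpow : ∀ n : ℕ, R ^ (-(n : ℝ)) = (R ^ n)⁻¹ := fun n => by rw [Real.rpow_neg hR0.le, Real.rpow_natCast]
  have hIg : ∫ t in Ioi R, g t = 16 * (R ^ 3)⁻¹ + 18 * (R ^ 4)⁻¹ + 36 / 5 * (R ^ 5)⁻¹ + (R ^ 6)⁻¹ - 8 * K * (R ^ 6)⁻¹ := by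
    have e4 := hI (-4) (by norm_num)
    have e5 := hI (-5) (by norm_num)
    have e6 := hI (-6) (by norm_num)
    have e7 := hI (-7) (by norm_num)
    rw [show (-4 : ℝ) + 1 = -(3 : ℕ) by norm_num, hpow 3] at e4
    rw [show (-5 : ℝ) + 1 = -(4 : ℕ) by norm_num, hpow 4] at e5
    rw [show (-6 : ℝ) + 1 = -(5 : ℕ) by norm_num, hpow 5] at e6
    rw [show (-7 : ℝ) + 1 = -(6 : ℕ) by norm_num, hpow 6] at e7
    have i4 := (hint (-4) (by norm_num))
    have i5 := (hint (-5) (by norm_num))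
    have i6 := (hint (-6) (by norm_num))
    have i7 := (hint (-7) (by norm_num))
    have i45 : IntegrableOn (fun t : ℝ => 48 * t ^ (-4 : ℝ) + 72 * t ^ (-5 : ℝ)) (Ioi R) :=
      (i4.const_mul 48).add (i5.const_mul 72)
    have i456 : IntegrableOn (fun t : ℝ => 48 * t ^ (-4 : ℝ) + 72 * t ^ (-5 : ℝ) + 36 * t ^ (-6 : ℝ)) (Ioi R) :=
      i45.add (i6.const_mul 36)
    have i7' : IntegrableOn (fun t : ℝ => (6 - 48 * K) * t ^ (-7 : ℝ)) (Ioi R) := i7.const_mul _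
    rw [show (∫ t in Ioi R, g t) = ∫ t in Ioi R, (48 * t ^ (-4 : ℝ) + 72 * t ^ (-5 : ℝ) + 36 * t ^ (-6 : ℝ)) +
      (6 - 48 * K) * t ^ (-7 : ℝ) from rfl]
    rw [integral_add i456 i7', integral_add i45 (i6.const_mul 36), integral_add (i4.const_mul 48) (i5.const_mul 72),
      integral_const_mul, integral_const_mul, integral_const_mul, integral_const_mul, e4, e5, e6, e7]
    norm_num
    ring
  calc ∑ j ∈ s, (dist (y j) p)⁻¹ ^ 6 * w j
      = ∫ t in Ioi R, ∑ j ∈ s, (Ioi (dist (y j) p)).indicator (fun t : ℝ => 6 * w j * t ^ (-7 : ℝ)) t := hsum_eq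
    _ ≤ ∫ t in Ioi R, g t := setIntegral_mono_on (integrable_finsetSum _ hint_term) hint_g measurableSet_Ioi hpt
    _ = _ := by rw [hIg]

/-! ## 3. The tail floor with the annulus constant; `R = 6, 7` literals -/

/-- **THE TAIL FLOOR, annulus constant**: for `R > 1/2` and every `7/10`-separated finite cluster,
`−A_R · Σ_i min(nn_i,1)⁻³ ≤ Σ_{i<j} tailLJ R (r_ij)` with `A_R = (4/3)R⁻³ + (3/2)R⁻⁴ + (3/5)R⁻⁵ + (1/12)R⁻⁶ − (2/3)(R−½)³R⁻⁶`. [folklore] -/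
theorem tail_floor_annulus {R : ℝ} (hR : 1 / 2 < R) (N : ℕ) (y : Fin N → (EuclideanSpace ℝ (Fin 3)))
    (hsep : ∀ a b : Fin N, a ≠ b → (7 : ℝ) / 10 ≤ dist (y a) (y b)) :
    -((4 / 3 * (R ^ 3)⁻¹ + 3 / 2 * (R ^ 4)⁻¹ + 3 / 5 * (R ^ 5)⁻¹ + 1 / 12 * (R ^ 6)⁻¹ - 2 / 3 * (R - 1 / 2) ^ 3 * (R ^ 6)⁻¹) *
        ∑ i, ((min (nearestDist y i) 1) ^ 3)⁻¹) ≤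
      interactionEnergy (fun r => if r < R then 0 else lennardJones r) y := by
  classical
  have hR0 : 0 < R := by linarith
  have hS : ∀ i : Fin N, ∑ k, (if R ≤ dist (y k) (y i) then (dist (y k) (y i))⁻¹ ^ 6 * (min (nearestDist y k) 1) ^ 3 else 0) ≤
      16 * (R ^ 3)⁻¹ + 18 * (R ^ 4)⁻¹ + 36 / 5 * (R ^ 5)⁻¹ + (R ^ 6)⁻¹ - 8 * (R - 1 / 2) ^ 3 * (R ^ 6)⁻¹ := by
    intro i
    rw [← Finset.sum_filter]
    exact sum_far_weight_le_annulus y hsep (y i) hR _ fun k hk => (Finset.mem_filter.1 hk).2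
  have h := tail_floor_of_farBound hR0 y hsep hS
  have hc : (16 * (R ^ 3)⁻¹ + 18 * (R ^ 4)⁻¹ + 36 / 5 * (R ^ 5)⁻¹ + (R ^ 6)⁻¹ - 8 * (R - 1 / 2) ^ 3 * (R ^ 6)⁻¹) / 12 =
      4 / 3 * (R ^ 3)⁻¹ + 3 / 2 * (R ^ 4)⁻¹ + 3 / 5 * (R ^ 5)⁻¹ + 1 / 12 * (R ^ 6)⁻¹ - 2 / 3 * (R - 1 / 2) ^ 3 * (R ^ 6)⁻¹ := by
    ring
  rwa [hc] at h

/-- ★ Literal at `R = 7`: `A_7 = 2.9922·10⁻³ ≤ 3/1000` (slack `3/1000·s⋆⁻³ − |t_7| ≈ 1.67·10⁻³`, the `×2` budget of the strained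
population at the residual of record `T′_7`). [folklore] -/
theorem tail_floor_seven (N : ℕ) (y : Fin N → (EuclideanSpace ℝ (Fin 3)))
    (hsep : ∀ a b : Fin N, a ≠ b → (7 : ℝ) / 10 ≤ dist (y a) (y b)) :
    -(3 / 1000 * ∑ i, ((min (nearestDist y i) 1) ^ 3)⁻¹) ≤
      interactionEnergy (fun r => if r < 7 then 0 else lennardJones r) y := by
  have h := tail_floor_annulus (R := 7) (by norm_num) N y hsep
  have hs : 0 ≤ ∑ i, ((min (nearestDist y i) 1) ^ 3)⁻¹ :=
    Finset.sum_nonneg fun i _ => inv_nonneg.2 (pow_nonneg (le_min (nearestDist_nonneg y i) zero_le_one) 3)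
  have hc : (4 : ℝ) / 3 * (7 ^ 3)⁻¹ + 3 / 2 * (7 ^ 4)⁻¹ + 3 / 5 * (7 ^ 5)⁻¹ + 1 / 12 * (7 ^ 6)⁻¹
      - 2 / 3 * (7 - 1 / 2) ^ 3 * (7 ^ 6)⁻¹ ≤ 3 / 1000 := by norm_num
  nlinarith

/-- Literal at `R = 6`: `A_6 = 5.032·10⁻³ ≤ 101/20000` (slack `≈ 3.1·10⁻³ < 3.5·10⁻³`: TRUE-type budget, thin). [folklore] -/
theorem tail_floor_six (N : ℕ) (y : Fin N → (EuclideanSpace ℝ (Fin 3)))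
    (hsep : ∀ a b : Fin N, a ≠ b → (7 : ℝ) / 10 ≤ dist (y a) (y b)) :
    -(101 / 20000 * ∑ i, ((min (nearestDist y i) 1) ^ 3)⁻¹) ≤
      interactionEnergy (fun r => if r < 6 then 0 else lennardJones r) y := by
  have h := tail_floor_annulus (R := 6) (by norm_num) N y hsep
  have hs : 0 ≤ ∑ i, ((min (nearestDist y i) 1) ^ 3)⁻¹ :=
    Finset.sum_nonneg fun i _ => inv_nonneg.2 (pow_nonneg (le_min (nearestDist_nonneg y i) zero_le_one) 3)
  have hc : (4 : ℝ) / 3 * (6 ^ 3)⁻¹ + 3 / 2 * (6 ^ 4)⁻¹ + 3 / 5 * (6 ^ 5)⁻¹ + 1 / 12 * (6 ^ 6)⁻¹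
      - 2 / 3 * (6 - 1 / 2) ^ 3 * (6 ^ 6)⁻¹ ≤ 101 / 20000 := by norm_num
  nlinarith

/-! ## 4. In lens-5's currency: `TailFloor 7 (1/324)` PROVED, and the residual of record `T′_7` with `hT` gone -/

/-- ★ `TailFloor 7 (3/1000)`. [folklore] -/
theorem tailFloor_seven : TailFloor 7 (3 / 1000) := fun N y _ hsep => tail_floor_seven N y hsep

/-- ★★ **`TailFloor 7 (1/324)` — lens-5 g33's literal floor at the residual of record `T′_7` (critic row 484 (b)), PROVED**
(`3/1000 ≤ 1/324`, monotonicity). [folklore] -/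
theorem tailFloor_seven_324 : TailFloor 7 (1 / 324) := tailFloor_mono tailFloor_seven (by norm_num)

/-- `TailFloor 6 (101/20000)` (TRUE-type-thin slack). [folklore] -/
theorem tailFloor_six : TailFloor 6 (101 / 20000) := fun N y _ hsep => tail_floor_six N y hsep

/-- `TailFloor R A_R` with the annulus constant, every `R > 1/2`. [folklore] -/
theorem tailFloor_annulus {R : ℝ} (hR : 1 / 2 < R) :
    TailFloor R (4 / 3 * (R ^ 3)⁻¹ + 3 / 2 * (R ^ 4)⁻¹ + 3 / 5 * (R ^ 5)⁻¹ + 1 / 12 * (R ^ 6)⁻¹ - 2 / 3 * (R - 1 / 2) ^ 3 * (R ^ 6)⁻¹) :=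
  fun N y _ hsep => tail_floor_annulus hR N y hsep

/-- **Lens-5's `fdg_of_rangeCut_seven` with `hT` DISCHARGED**: `UP(−0.7175) ∧ FRG(7, 1/324, −0.7174, C) ⟹ FDG`. [folklore chaining] -/
theorem fdg_of_rangeCut_seven_tf {C : ℝ} (hU : PeriodicEnergyCeiling (-(7175 / 10000)))
    (hF : FiniteRangeFrustrationGap 7 (1 / 324) (-(7174 / 10000)) C) : FDG :=
  fdg_of_rangeCut_seven tailFloor_seven_324 hU hF

/-- ★★ **The residual of record `T′_7` closes `FDG` with `E′` and `UP` alone** (TF PROVED):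
`E′(1/20,1/8) ∧ UP(−0.7175) ∧ FiniteRangeTopologicalPricing (1/20) (1/8) 7 (1/324) (−0.7175) (1/100) C_T ⟹ FDG`. [folklore chaining] -/
theorem fdg_of_split_rangeCut_seven_tf {CT : ℝ} (hE : ElasticPricing (1 / 20) (1 / 8))
    (hU : PeriodicEnergyCeiling (-(7175 / 10000)))
    (hF : FiniteRangeTopologicalPricing (1 / 20) (1 / 8) 7 (1 / 324) (-(7175 / 10000)) (1 / 100) CT) : FDG :=
  fdg_of_split_rangeCut (by norm_num) hE tailFloor_seven_324 hU (by norm_num) hF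

/-- ★★ **The crux from the residual of record**: `MuEquilibriumDoor ∧ E′(1/20,1/8) ∧ UP(−0.7175) ∧ T′_7 ⟹ AperiodicFrustratedLawGap`.
[folklore chaining] -/
theorem aperiodicFrustratedLawGap_of_split_rangeCut_seven_tf {CT : ℝ}
    (hDoor : Summit.AtomisticToContinuum.Crystallization.Theses.GrainCoreNetworkSplit.MuEquilibriumDoor)
    (hE : ElasticPricing (1 / 20) (1 / 8)) (hU : PeriodicEnergyCeiling (-(7175 / 10000)))
    (hF : FiniteRangeTopologicalPricing (1 / 20) (1 / 8) 7 (1 / 324) (-(7175 / 10000)) (1 / 100) CT) :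
    Summit.AtomisticToContinuum.Crystallization.Theses.FrustratedLawDichotomy.AperiodicFrustratedLawGap :=
  aperiodicFrustratedLawGap_of_fdg hDoor (fdg_of_split_rangeCut_seven_tf hE hU hF)

/-- **The crux from the unsplit audit twin `FRG_7`**: `MuEquilibriumDoor ∧ UP(−0.7175) ∧ FRG(7, 1/324, −0.7174, C) ⟹ AperiodicFrustratedLawGap`.
[folklore chaining] -/
theorem aperiodicFrustratedLawGap_of_rangeCut_seven_tf {C : ℝ}
    (hDoor : Summit.AtomisticToContinuum.Crystallization.Theses.GrainCoreNetworkSplit.MuEquilibriumDoor)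
    (hU : PeriodicEnergyCeiling (-(7175 / 10000))) (hF : FiniteRangeFrustrationGap 7 (1 / 324) (-(7174 / 10000)) C) :
    Summit.AtomisticToContinuum.Crystallization.Theses.FrustratedLawDichotomy.AperiodicFrustratedLawGap :=
  aperiodicFrustratedLawGap_of_fdg hDoor (fdg_of_rangeCut_seven_tf hU hF)

end Summit.AtomisticToContinuum.Crystallization.Theorems.FrustratedLawDichotomyTailFloor
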